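import Mathlib.Algebra.Polynomial.Eval.Defs
import Summits.PneNP.PneNP.Theorems.SymmetryBudgetNoHiddenOrderProgramGates
import Summits.PneNP.PneNP.Theorems.SymmetryBudgetNoHiddenOrderFLabCard

/-!
# `NoHiddenOrder` (stmt-PneNP-14781), (R2c) VI: the window canoniser program — the gate type has polynomially many elements

Route `PneNP/SymmetryBudget`; companion of `…ProgramGates.lean` (seat -1's gate type `WCanon.Gt m`).  The size entry of the graph-level
socket (`noHiddenOrder_of_graphProgram`: `2·|Λ| + 2 ≤ q(m)` for all large `m`) for `Λ := Gt m`.  Every gate shape is a finite sum of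
products of LEAF index types (window vertices `WV m`, colours / thresholds / bit positions `Fin _`, part blocks `Finset (WV m)`,
admissible labels `FLab m`, smaller shapes); we bound each shape by `c · M ^ d` whenever all its leaves have at most `M` elements
(`card_CCGate_le`, …, `card_Gt_le`), by embedding the `deriving Fintype` proxy type leafwise into products of `Fin M` (decomposing along sums / constant sigmas / products down to the leaf embeddings in context) — and then chain the
bounds from `|WV m| = ⌊log₂ m⌋ ≤ m`, `|Finset (WV m)| = 2^{⌊log₂ m⌋} ≤ m` and `|FLab m| ≤ m^18` (`card_FLab_le`):
**`card_Gt_le_pow : 2 ≤ m → Fintype.card (Gt m) ≤ m ^ 4050`**, hence `eventually_size_Gt : ∀ᶠ m, 2·|Gt m| + 2 ≤ (X ^ 4051).eval m`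
(the exponent is what the uniform bookkeeping gives; nothing here is tight).  Sorry-free; supports stmt-PneNP-14781, does not close it.
-/

set_option linter.dupNamespace false -- `Summit.PneNP.PneNP.…` (D-0017 single-conjunct layout)
set_option synthInstance.maxSize 4096 -- `Fintype` instances on the wide proxy sums
set_option synthInstance.maxHeartbeats 400000

namespace Summit.PneNP.PneNP.Theorems

open Finset Filter CGBits BranchSum

namespace WCanon

variable {m : ℕ}

/-! ### Leafwise embeddings -/

/-- Embedding a constant sigma type into a product, leafwise. [folklore] -/
def sigEmb {A B A' B' : Type*} (f : A ↪ A') (g : B ↪ B') : ((_ : A) × B) ↪ A' × B' :=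
  (Equiv.sigmaEquivProd A B).toEmbedding.trans (f.prodMap g)

/-- A finite type of cardinality at most `M` embeds in `Fin M`. [folklore] -/
theorem nonempty_embedding_fin {α : Type*} [Fintype α] {M : ℕ} (h : Fintype.card α ≤ M) : Nonempty (α ↪ Fin M) :=
  Function.Embedding.nonempty_iff_card_le.2 (by simpa using h)

/-- `Fin k` embeds in `Fin M` for `k ≤ M`. [folklore] -/
theorem nonempty_fin_embedding_fin {k M : ℕ} (h : k ≤ M) : Nonempty (Fin k ↪ Fin M) := ⟨Fin.castLEEmb h⟩

/-- `Unit` embeds in `Fin M` for `1 ≤ M`. [folklore] -/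
theorem nonempty_unit_embedding_fin {M : ℕ} (h : 1 ≤ M) : Nonempty (Unit ↪ Fin M) :=
  ⟨⟨fun _ => ⟨0, h⟩, fun _ _ _ => rfl⟩⟩

/-- Powers below the top degree. [folklore] -/
theorem pow_le_pow_of_le_deg {M k d : ℕ} (hM : 1 ≤ M) (h : k ≤ d) : M ^ k ≤ M ^ d := Nat.pow_le_pow_right hM h

/-! ### The shapes, leafwise -/

/-- `|CCGate m| ≤ 9M`. [folklore] -/
theorem card_CCGate_le {M : ℕ} (hM : 1 ≤ M) (hP : pN m + 1 ≤ M) : Fintype.card (CCGate m) ≤ 9 * M := by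
  obtain ⟨eP⟩ := nonempty_fin_embedding_fin hP
  obtain ⟨eU⟩ := nonempty_unit_embedding_fin hM
  have h := Fintype.card_le_of_embedding ((CCGate.proxyTypeEquiv m).symm.toEmbedding.trans 
    (by repeat' (first | apply Function.Embedding.sumMap | apply sigEmb | apply Function.Embedding.prodMap | assumption) :
      CCGate.proxyType m ↪ _))
  simp only [Fintype.card_sum, Fintype.card_fin] at h
  omega

/-- `|CTGate m| ≤ 5M`. [folklore] -/
theorem card_CTGate_le {M : ℕ} (hM : 1 ≤ M) (hP : pN m + 1 ≤ M) : Fintype.card (CTGate m) ≤ 5 * M := by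
  obtain ⟨eP⟩ := nonempty_fin_embedding_fin hP
  obtain ⟨eU⟩ := nonempty_unit_embedding_fin hM
  have h := Fintype.card_le_of_embedding ((CTGate.proxyTypeEquiv m).symm.toEmbedding.trans 
    (by repeat' (first | apply Function.Embedding.sumMap | apply sigEmb | apply Function.Embedding.prodMap | assumption) :
      CTGate.proxyType m ↪ _))
  simp only [Fintype.card_sum, Fintype.card_fin] at h
  omega

/-- `|RIGate m| ≤ 17M⁵`. [folklore] -/
theorem card_RIGate_le {M : ℕ} (hM : 1 ≤ M) (hV : Fintype.card (WV m) ≤ M) (hW : wn m + 1 ≤ M)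
    (hCC : Fintype.card (CCGate m) ≤ M) : Fintype.card (RIGate m) ≤ 17 * M ^ 5 := by
  obtain ⟨eV⟩ := nonempty_embedding_fin hV
  obtain ⟨eF⟩ : Nonempty (Fin (wn m) ↪ Fin M) := nonempty_fin_embedding_fin (by omega)
  obtain ⟨eF1⟩ : Nonempty (Fin (wn m + 1) ↪ Fin M) := nonempty_fin_embedding_fin hW
  obtain ⟨eCC⟩ := nonempty_embedding_fin hCC
  have h := Fintype.card_le_of_embedding ((RIGate.proxyTypeEquiv m).symm.toEmbedding.trans 
    (by repeat' (first | apply Function.Embedding.sumMap | apply sigEmb | apply Function.Embedding.prodMap | assumption) :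
      RIGate.proxyType m ↪ _))
  simp only [Fintype.card_sum, Fintype.card_prod, Fintype.card_fin] at h
  have h0 := pow_le_pow_of_le_deg hM (show 0 ≤ 5 by omega)
  have h1 := pow_le_pow_of_le_deg hM (show 1 ≤ 5 by omega)
  have h2 := pow_le_pow_of_le_deg hM (show 2 ≤ 5 by omega)
  have h3 := pow_le_pow_of_le_deg hM (show 3 ≤ 5 by omega)
  have h4 := pow_le_pow_of_le_deg hM (show 4 ≤ 5 by omega)
  ring_nf at h h0 h1 h2 h3 h4 ⊢
  omega

/-- `|VSGate m| ≤ 7M³`. [folklore] -/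
theorem card_VSGate_le {M : ℕ} (hM : 1 ≤ M) (hV : Fintype.card (WV m) ≤ M) (hmm : m + m ≤ M) : Fintype.card (VSGate m) ≤ 7 * M ^ 3 := by
  obtain ⟨eV⟩ := nonempty_embedding_fin hV
  obtain ⟨eJ⟩ : Nonempty (Fin (m + m) ↪ Fin M) := nonempty_fin_embedding_fin hmm
  have h := Fintype.card_le_of_embedding ((VSGate.proxyTypeEquiv m).symm.toEmbedding.trans 
    (by repeat' (first | apply Function.Embedding.sumMap | apply sigEmb | apply Function.Embedding.prodMap | assumption) :
      VSGate.proxyType m ↪ _))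
  simp only [Fintype.card_sum, Fintype.card_prod, Fintype.card_fin] at h
  have h0 := pow_le_pow_of_le_deg hM (show 0 ≤ 3 by omega)
  have h1 := pow_le_pow_of_le_deg hM (show 1 ≤ 3 by omega)
  have h2 := pow_le_pow_of_le_deg hM (show 2 ≤ 3 by omega)
  ring_nf at h h0 h1 h2 ⊢
  omega

/-- `|VOGate m| ≤ 7M⁵`. [folklore] -/
theorem card_VOGate_le {M : ℕ} (hM : 1 ≤ M) (hV : Fintype.card (WV m) ≤ M) (hW : wn m ≤ M) (hB : NB (wn m) ≤ M) :
    Fintype.card (VOGate m) ≤ 7 * M ^ 5 := by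
  obtain ⟨eV⟩ := nonempty_embedding_fin hV
  obtain ⟨eF⟩ : Nonempty (Fin (wn m) ↪ Fin M) := nonempty_fin_embedding_fin hW
  obtain ⟨eB⟩ : Nonempty (Fin (NB (wn m)) ↪ Fin M) := nonempty_fin_embedding_fin hB
  have h := Fintype.card_le_of_embedding ((VOGate.proxyTypeEquiv m).symm.toEmbedding.trans 
    (by repeat' (first | apply Function.Embedding.sumMap | apply sigEmb | apply Function.Embedding.prodMap | assumption) :
      VOGate.proxyType m ↪ _))
  simp only [Fintype.card_sum, Fintype.card_prod, Fintype.card_fin] at h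
  have h0 := pow_le_pow_of_le_deg hM (show 0 ≤ 5 by omega)
  have h1 := pow_le_pow_of_le_deg hM (show 1 ≤ 5 by omega)
  have h2 := pow_le_pow_of_le_deg hM (show 2 ≤ 5 by omega)
  have h3 := pow_le_pow_of_le_deg hM (show 3 ≤ 5 by omega)
  have h4 := pow_le_pow_of_le_deg hM (show 4 ≤ 5 by omega)
  ring_nf at h h0 h1 h2 h3 h4 ⊢
  omega

/-- `|VAGate m| ≤ 7M³`. [folklore] -/
theorem card_VAGate_le {M : ℕ} (hM : 1 ≤ M) (hS : Fintype.card (Finset (WV m)) ≤ M) (hB : NB (wn m) ≤ M) :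
    Fintype.card (VAGate m) ≤ 7 * M ^ 3 := by
  obtain ⟨eS⟩ := nonempty_embedding_fin hS
  obtain ⟨eB⟩ : Nonempty (Fin (NB (wn m)) ↪ Fin M) := nonempty_fin_embedding_fin hB
  have h := Fintype.card_le_of_embedding ((VAGate.proxyTypeEquiv m).symm.toEmbedding.trans 
    (by repeat' (first | apply Function.Embedding.sumMap | apply sigEmb | apply Function.Embedding.prodMap | assumption) :
      VAGate.proxyType m ↪ _))
  simp only [Fintype.card_sum, Fintype.card_prod, Fintype.card_fin] at h
  have h0 := pow_le_pow_of_le_deg hM (show 0 ≤ 3 by omega)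
  have h1 := pow_le_pow_of_le_deg hM (show 1 ≤ 3 by omega)
  have h2 := pow_le_pow_of_le_deg hM (show 2 ≤ 3 by omega)
  ring_nf at h h0 h1 h2 ⊢
  omega

/-- `|AnGate m| ≤ 45M⁴`. [folklore] -/
theorem card_AnGate_le {M : ℕ} (hM : 1 ≤ M) (hV : Fintype.card (WV m) ≤ M) (hW : wn m + 1 ≤ M)
    (hCT : Fintype.card (CTGate m) ≤ M) (hCC : Fintype.card (CCGate m) ≤ M) : Fintype.card (AnGate m) ≤ 45 * M ^ 4 := by
  obtain ⟨eV⟩ := nonempty_embedding_fin hV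
  obtain ⟨eF⟩ : Nonempty (Fin (wn m) ↪ Fin M) := nonempty_fin_embedding_fin (by omega)
  obtain ⟨eF1⟩ : Nonempty (Fin (wn m + 1) ↪ Fin M) := nonempty_fin_embedding_fin hW
  obtain ⟨eU⟩ := nonempty_unit_embedding_fin hM
  obtain ⟨eCT⟩ := nonempty_embedding_fin hCT
  obtain ⟨eCC⟩ := nonempty_embedding_fin hCC
  have h := Fintype.card_le_of_embedding ((AnGate.proxyTypeEquiv m).symm.toEmbedding.trans 
    (by repeat' (first | apply Function.Embedding.sumMap | apply sigEmb | apply Function.Embedding.prodMap | assumption) :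
      AnGate.proxyType m ↪ _))
  simp only [Fintype.card_sum, Fintype.card_prod, Fintype.card_fin] at h
  have h0 := pow_le_pow_of_le_deg hM (show 0 ≤ 4 by omega)
  have h1 := pow_le_pow_of_le_deg hM (show 1 ≤ 4 by omega)
  have h2 := pow_le_pow_of_le_deg hM (show 2 ≤ 4 by omega)
  have h3 := pow_le_pow_of_le_deg hM (show 3 ≤ 4 by omega)
  ring_nf at h h0 h1 h2 h3 ⊢
  omega

/-- `|TrGate m| ≤ 25M²`. [folklore] -/
theorem card_TrGate_le {M : ℕ} (hM : 1 ≤ M) (hV : Fintype.card (WV m) ≤ M) (hW : wn m ≤ M)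
    (hRI : Fintype.card (RIGate m) ≤ M) : Fintype.card (TrGate m) ≤ 25 * M ^ 2 := by
  obtain ⟨eV⟩ := nonempty_embedding_fin hV
  obtain ⟨eF⟩ : Nonempty (Fin (wn m) ↪ Fin M) := nonempty_fin_embedding_fin hW
  obtain ⟨eU⟩ := nonempty_unit_embedding_fin hM
  obtain ⟨eRI⟩ := nonempty_embedding_fin hRI
  have h := Fintype.card_le_of_embedding ((TrGate.proxyTypeEquiv m).symm.toEmbedding.trans 
    (by repeat' (first | apply Function.Embedding.sumMap | apply sigEmb | apply Function.Embedding.prodMap | assumption) :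
      TrGate.proxyType m ↪ _))
  simp only [Fintype.card_sum, Fintype.card_prod, Fintype.card_fin] at h
  have h0 := pow_le_pow_of_le_deg hM (show 0 ≤ 2 by omega)
  have h1 := pow_le_pow_of_le_deg hM (show 1 ≤ 2 by omega)
  ring_nf at h h0 h1 ⊢
  omega

/-- `|OrGate m| ≤ 19M⁵`. [folklore] -/
theorem card_OrGate_le {M : ℕ} (hM : 1 ≤ M) (hV : Fintype.card (WV m) ≤ M) (hW : wn m ≤ M) (hB : NB (wn m) ≤ M)
    (hRI : Fintype.card (RIGate m) ≤ M) (hVO : Fintype.card (VOGate m) ≤ M) : Fintype.card (OrGate m) ≤ 19 * M ^ 5 := by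
  obtain ⟨eV⟩ := nonempty_embedding_fin hV
  obtain ⟨eF⟩ : Nonempty (Fin (wn m) ↪ Fin M) := nonempty_fin_embedding_fin hW
  obtain ⟨eB⟩ : Nonempty (Fin (NB (wn m)) ↪ Fin M) := nonempty_fin_embedding_fin hB
  obtain ⟨eU⟩ := nonempty_unit_embedding_fin hM
  obtain ⟨eRI⟩ := nonempty_embedding_fin hRI
  obtain ⟨eVO⟩ := nonempty_embedding_fin hVO
  have h := Fintype.card_le_of_embedding ((OrGate.proxyTypeEquiv m).symm.toEmbedding.trans 
    (by repeat' (first | apply Function.Embedding.sumMap | apply sigEmb | apply Function.Embedding.prodMap | assumption) :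
      OrGate.proxyType m ↪ _))
  simp only [Fintype.card_sum, Fintype.card_prod, Fintype.card_fin] at h
  have h0 := pow_le_pow_of_le_deg hM (show 0 ≤ 5 by omega)
  have h1 := pow_le_pow_of_le_deg hM (show 1 ≤ 5 by omega)
  have h2 := pow_le_pow_of_le_deg hM (show 2 ≤ 5 by omega)
  have h3 := pow_le_pow_of_le_deg hM (show 3 ≤ 5 by omega)
  have h4 := pow_le_pow_of_le_deg hM (show 4 ≤ 5 by omega)
  ring_nf at h h0 h1 h2 h3 h4 ⊢
  omega

/-- `|AndGate m| ≤ 27M⁶`. [folklore] -/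
theorem card_AndGate_le {M : ℕ} (hM : 1 ≤ M) (hV : Fintype.card (WV m) ≤ M) (hW : wn m + 2 ≤ M)
    (hS : Fintype.card (Finset (WV m)) ≤ M) (hVA : Fintype.card (VAGate m) ≤ M) : Fintype.card (AndGate m) ≤ 27 * M ^ 6 := by
  obtain ⟨eV⟩ := nonempty_embedding_fin hV
  obtain ⟨eF⟩ : Nonempty (Fin (wn m) ↪ Fin M) := nonempty_fin_embedding_fin (by omega)
  obtain ⟨eF1⟩ : Nonempty (Fin (wn m + 1) ↪ Fin M) := nonempty_fin_embedding_fin (by omega)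
  obtain ⟨eF2⟩ : Nonempty (Fin (wn m + 2) ↪ Fin M) := nonempty_fin_embedding_fin hW
  obtain ⟨eU⟩ := nonempty_unit_embedding_fin hM
  obtain ⟨eS⟩ := nonempty_embedding_fin hS
  obtain ⟨eVA⟩ := nonempty_embedding_fin hVA
  have h := Fintype.card_le_of_embedding ((AndGate.proxyTypeEquiv m).symm.toEmbedding.trans 
    (by repeat' (first | apply Function.Embedding.sumMap | apply sigEmb | apply Function.Embedding.prodMap | assumption) :
      AndGate.proxyType m ↪ _))
  simp only [Fintype.card_sum, Fintype.card_prod, Fintype.card_fin] at h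
  have h0 := pow_le_pow_of_le_deg hM (show 0 ≤ 6 by omega)
  have h1 := pow_le_pow_of_le_deg hM (show 1 ≤ 6 by omega)
  have h2 := pow_le_pow_of_le_deg hM (show 2 ≤ 6 by omega)
  have h3 := pow_le_pow_of_le_deg hM (show 3 ≤ 6 by omega)
  have h4 := pow_le_pow_of_le_deg hM (show 4 ≤ 6 by omega)
  have h5 := pow_le_pow_of_le_deg hM (show 5 ≤ 6 by omega)
  ring_nf at h h0 h1 h2 h3 h4 h5 ⊢
  omega

/-- `|VlGate m| ≤ 10M`. [folklore] -/
theorem card_VlGate_le {M : ℕ} (hM : 1 ≤ M) (hB : NB (wn m) ≤ M) : Fintype.card (VlGate m) ≤ 10 * M := by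
  obtain ⟨eB⟩ : Nonempty (Fin (NB (wn m)) ↪ Fin M) := nonempty_fin_embedding_fin hB
  obtain ⟨eU⟩ := nonempty_unit_embedding_fin hM
  have h := Fintype.card_le_of_embedding ((VlGate.proxyTypeEquiv m).symm.toEmbedding.trans 
    (by repeat' (first | apply Function.Embedding.sumMap | apply sigEmb | apply Function.Embedding.prodMap | assumption) :
      VlGate.proxyType m ↪ _))
  simp only [Fintype.card_sum, Fintype.card_fin] at h
  omega

/-- `|Gt m| ≤ 13M⁴`. [folklore] -/
theorem card_Gt_le {M : ℕ} (hM : 1 ≤ M) (hV : Fintype.card (WV m) ≤ M) (hm : m ≤ M) (hW : wn m ≤ M) (hPF : pF m + 1 ≤ M)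
    (hL : Fintype.card (FLab m) ≤ M) (hVS : Fintype.card (VSGate m) ≤ M) (hRI : Fintype.card (RIGate m) ≤ M)
    (hAn : Fintype.card (AnGate m) ≤ M) (hTr : Fintype.card (TrGate m) ≤ M) (hOr : Fintype.card (OrGate m) ≤ M)
    (hAnd : Fintype.card (AndGate m) ≤ M) (hVl : Fintype.card (VlGate m) ≤ M) : Fintype.card (Gt m) ≤ 13 * M ^ 4 := by
  obtain ⟨eV⟩ := nonempty_embedding_fin hV
  obtain ⟨eI⟩ : Nonempty (Fin m ↪ Fin M) := nonempty_fin_embedding_fin hm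
  obtain ⟨eF⟩ : Nonempty (Fin (wn m) ↪ Fin M) := nonempty_fin_embedding_fin hW
  obtain ⟨eP⟩ : Nonempty (Fin (pF m) ↪ Fin M) := nonempty_fin_embedding_fin (by omega)
  obtain ⟨eP1⟩ : Nonempty (Fin (pF m + 1) ↪ Fin M) := nonempty_fin_embedding_fin hPF
  obtain ⟨eU⟩ := nonempty_unit_embedding_fin hM
  obtain ⟨eL⟩ := nonempty_embedding_fin hL
  obtain ⟨eVS⟩ := nonempty_embedding_fin hVS
  obtain ⟨eRI⟩ := nonempty_embedding_fin hRI
  obtain ⟨eAn⟩ := nonempty_embedding_fin hAn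
  obtain ⟨eTr⟩ := nonempty_embedding_fin hTr
  obtain ⟨eOr⟩ := nonempty_embedding_fin hOr
  obtain ⟨eAnd⟩ := nonempty_embedding_fin hAnd
  obtain ⟨eVl⟩ := nonempty_embedding_fin hVl
  have h := Fintype.card_le_of_embedding ((Gt.proxyTypeEquiv m).symm.toEmbedding.trans 
    (by repeat' (first | apply Function.Embedding.sumMap | apply sigEmb | apply Function.Embedding.prodMap | assumption) :
      Gt.proxyType m ↪ _))
  simp only [Fintype.card_sum, Fintype.card_prod, Fintype.card_fin] at h
  have h0 := pow_le_pow_of_le_deg hM (show 0 ≤ 4 by omega)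
  have h1 := pow_le_pow_of_le_deg hM (show 1 ≤ 4 by omega)
  have h2 := pow_le_pow_of_le_deg hM (show 2 ≤ 4 by omega)
  have h3 := pow_le_pow_of_le_deg hM (show 3 ≤ 4 by omega)
  ring_nf at h h0 h1 h2 h3 ⊢
  omega

/-! ### Chaining the bounds in powers of `m ^ 18` -/

/-- Absorbing a constant: `c · B^a ≤ B^(a+1)` once `c ≤ B`. [folklore] -/
theorem const_mul_pow_le {B c a x : ℕ} (hc : c ≤ B) (h : x ≤ c * B ^ a) : x ≤ B ^ (a + 1) := by
  calc x ≤ c * B ^ a := h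
    _ ≤ B * B ^ a := Nat.mul_le_mul_right _ hc
    _ = B ^ (a + 1) := by ring

/-- Lifting a bound to a higher power of the base. [folklore] -/
theorem le_pow_of_le_pow {B a b x : ℕ} (hB : 1 ≤ B) (hab : a ≤ b) (h : x ≤ B ^ a) : x ≤ B ^ b :=
  h.trans (Nat.pow_le_pow_right hB hab)

/-- The window size is at most `m`. [folklore] -/
theorem wn_le (m : ℕ) : wn m ≤ m := by
  unfold wn; exact (Finset.card_le_univ _).trans (by simp)

/-- **The gate type is polynomial**: `|Gt m| ≤ m ^ 4050` for `m ≥ 2`. [folklore] -/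
theorem card_Gt_le_pow {m : ℕ} (hm : 2 ≤ m) : Fintype.card (Gt m) ≤ m ^ 4050 := by
  -- the base `B = m ^ 18`, kept opaque
  obtain ⟨B, hB⟩ : ∃ B, B = m ^ 18 := ⟨_, rfl⟩
  have hm1 : 1 ≤ m := by omega
  have hB1 : 1 ≤ B := hB ▸ Nat.one_le_pow _ _ hm1
  have Bk : ∀ {a b : ℕ}, a ≤ b → B ^ a ≤ B ^ b := fun h => Nat.pow_le_pow_right hB1 h
  have upk : ∀ {x a b : ℕ}, a ≤ b → x ≤ B ^ a → x ≤ B ^ b := fun hab h => h.trans (Bk hab)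
  have up1 : ∀ {x : ℕ}, x ≤ B → x ≤ B ^ 1 := fun h => h.trans_eq (pow_one B).symm
  -- primitive leaves
  have hsq : m ^ 2 = m * m := sq m
  have hmsq : m ≤ m ^ 2 := Nat.le_self_pow (by norm_num) m
  have h4sq : 4 * m ^ 2 ≤ m ^ 2 * m ^ 2 := Nat.mul_le_mul_right _ (by nlinarith)
  have hm4B : m ^ 2 * m ^ 2 ≤ B := by
    rw [hB, ← pow_add]; exact Nat.pow_le_pow_right hm1 (by norm_num)
  have hmB : m ≤ B := by omega
  have h64 : 64 ≤ B := hB ▸ le_trans (by norm_num : 64 ≤ 2 ^ 18) (Nat.pow_le_pow_left hm 18)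
  have hwn : wn m ≤ m := wn_le m
  have hwn2 : wn m * wn m ≤ m ^ 2 := hsq ▸ Nat.mul_le_mul hwn hwn
  have hV : Fintype.card (WV m) ≤ B := by rw [card_WV]; omega
  have hW2 : wn m + 2 ≤ B := by omega
  have hPN : pN m + 1 ≤ B := by unfold pN; omega
  have hNB : NB (wn m) ≤ B := by unfold NB; omega
  have hPF : pF m + 1 ≤ B := by unfold pF; omega
  have hmm : m + m ≤ B := by omega
  have hS : Fintype.card (Finset (WV m)) ≤ B := by
    rw [Fintype.card_finset, card_WV]
    exact (two_pow_card_windowSet_le hm1).trans hmB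
  have hL : Fintype.card (FLab m) ≤ B := hB ▸ card_FLab_le hm1
  -- absorbing constants `c ≤ 64 ≤ B`
  have absorb : ∀ {x c a : ℕ}, c ≤ 64 → x ≤ c * B ^ a → x ≤ B ^ (a + 1) := fun hc h => const_mul_pow_le (hc.trans h64) h
  -- the small shapes (leaves at most `B`)
  have hCC : Fintype.card (CCGate m) ≤ B ^ 2 :=
    absorb (by norm_num) (show Fintype.card (CCGate m) ≤ 9 * B ^ 1 by rw [pow_one]; exact card_CCGate_le hB1 hPN)
  have hCT : Fintype.card (CTGate m) ≤ B ^ 2 :=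
    absorb (by norm_num) (show Fintype.card (CTGate m) ≤ 5 * B ^ 1 by rw [pow_one]; exact card_CTGate_le hB1 hPN)
  have hVl : Fintype.card (VlGate m) ≤ B ^ 2 :=
    absorb (by norm_num) (show Fintype.card (VlGate m) ≤ 10 * B ^ 1 by rw [pow_one]; exact card_VlGate_le hB1 hNB)
  have hVS : Fintype.card (VSGate m) ≤ B ^ 4 := absorb (by norm_num) (card_VSGate_le hB1 hV hmm)
  have hVA : Fintype.card (VAGate m) ≤ B ^ 4 := absorb (by norm_num) (card_VAGate_le hB1 hS hNB)
  have hVO : Fintype.card (VOGate m) ≤ B ^ 6 := absorb (by norm_num) (card_VOGate_le hB1 hV (by omega) hNB)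
  -- leaves at most `B ^ 2`
  have hB2 : 1 ≤ B ^ 2 := Nat.one_le_pow _ _ hB1
  have hRI : Fintype.card (RIGate m) ≤ B ^ 11 := by
    have h := card_RIGate_le (M := B ^ 2) hB2 (upk (by norm_num) (up1 hV)) (upk (by norm_num) (up1 (by omega))) hCC
    rw [← pow_mul] at h
    exact absorb (by norm_num) h
  have hAn : Fintype.card (AnGate m) ≤ B ^ 9 := by
    have h := card_AnGate_le (M := B ^ 2) hB2 (upk (by norm_num) (up1 hV)) (upk (by norm_num) (up1 (by omega))) hCT hCC
    rw [← pow_mul] at h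
    exact absorb (by norm_num) h
  -- leaves at most `B ^ 11`
  have hB11 : 1 ≤ B ^ 11 := Nat.one_le_pow _ _ hB1
  have hTr : Fintype.card (TrGate m) ≤ B ^ 23 := by
    have h := card_TrGate_le (M := B ^ 11) hB11 (upk (by norm_num) (up1 hV)) (upk (by norm_num) (up1 (by omega))) hRI
    rw [← pow_mul] at h
    exact absorb (by norm_num) h
  have hOr : Fintype.card (OrGate m) ≤ B ^ 56 := by
    have h := card_OrGate_le (M := B ^ 11) hB11 (upk (by norm_num) (up1 hV)) (upk (by norm_num) (up1 (by omega)))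
      (upk (by norm_num) (up1 hNB)) hRI (upk (by norm_num) hVO)
    rw [← pow_mul] at h
    exact absorb (by norm_num) h
  -- leaves at most `B ^ 4`
  have hB4 : 1 ≤ B ^ 4 := Nat.one_le_pow _ _ hB1
  have hAnd : Fintype.card (AndGate m) ≤ B ^ 25 := by
    have h := card_AndGate_le (M := B ^ 4) hB4 (upk (by norm_num) (up1 hV)) (upk (by norm_num) (up1 hW2))
      (upk (by norm_num) (up1 hS)) hVA
    rw [← pow_mul] at h
    exact absorb (by norm_num) h
  -- the gate type, leaves at most `B ^ 56`
  have hB56 : 1 ≤ B ^ 56 := Nat.one_le_pow _ _ hB1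
  have hGt := card_Gt_le (M := B ^ 56) hB56 (upk (by norm_num) (up1 hV)) (upk (by norm_num) (up1 hmB))
    (upk (by norm_num) (up1 (by omega))) (upk (by norm_num) (up1 hPF)) (upk (by norm_num) (up1 hL)) (upk (by norm_num) hVS)
    (upk (by norm_num) hRI) (upk (by norm_num) hAn) (upk (by norm_num) hTr) hOr (upk (by norm_num) hAnd) (upk (by norm_num) hVl)
  rw [← pow_mul] at hGt
  have h225 : Fintype.card (Gt m) ≤ B ^ 225 := absorb (by norm_num) hGt
  calc Fintype.card (Gt m) ≤ B ^ 225 := h225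
    _ = m ^ 4050 := by rw [hB, ← pow_mul]

/-- From a polynomial bound for `m ≥ 2` to the size entry of the socket. [folklore] -/
theorem eventually_size_of_pow_bound {f : ℕ → ℕ} {d : ℕ} (h : ∀ m, 2 ≤ m → f m ≤ m ^ d) :
    ∀ᶠ m : ℕ in atTop, 2 * f m + 2 ≤ (Polynomial.X ^ (d + 1) : Polynomial ℕ).eval m := by
  filter_upwards [eventually_ge_atTop 4] with m hm
  rw [Polynomial.eval_pow, Polynomial.eval_X, pow_succ]
  have h0 := h m (by omega)
  have h1 : 1 ≤ m ^ d := Nat.one_le_pow d m (by omega)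
  have h2 : 4 * m ^ d ≤ m ^ d * m := by rw [mul_comm]; exact Nat.mul_le_mul_left _ hm
  omega

/-- **The size entry of the socket**: for all large `m`, `2·|Gt m| + 2 ≤ m ^ 4051 = (X ^ 4051).eval m`. [folklore] -/
theorem eventually_size_Gt : ∀ᶠ m : ℕ in atTop, 2 * Fintype.card (Gt m) + 2 ≤ (Polynomial.X ^ 4051 : Polynomial ℕ).eval m :=
  eventually_size_of_pow_bound fun _ hm => card_Gt_le_pow hm

end WCanon

end Summit.PneNP.PneNP.Theorems
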